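import Mathlib
import HarnessLib
import Summits.HubbardSuperconductivity.HubbardSuperconductivity.Theorems.KLProgrammeKLRegimeTwoVolumeTowerTransferWtData
import Summits.HubbardSuperconductivity.HubbardSuperconductivity.Theorems.KLProgrammeKLRegimeSectorSliceRowsChain

/-!
# K3 VL child `KLRegimeVolumeLimitV17F2` (stmt-HubbardSuperconductivity-20440), located item #23 «W2-HALF-VL», part 2: THE FRAME TELESCOPE ON THE
# TOWER'S OBJECTS — `ScaleCovData` / `ScaleCovSecData` of `klStepCov` and `TransferWtData` of `klSrcTransfer` at the LAST frame of a frame chain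
# from the data at the FIRST frame plus per-step FAMILY and COVARIANCE pieces (the call shape of record for the shallow steps)

Cell `gate-hubbard-kl`, seat p3 (g13), lead of #23 (pen (R110)).  A shallow step `k` reaches the top frame `K_{n⋆}` by a telescope
`K_{m₀} → ⋯ → K_{m₀+d} = K_{n⋆}` along the flow frames: base = p3's door at `K_{m₀}` (`…TowerStepCovDataAt`), Gram/entry at the top window-free
(`…TowerStepCovGram`), each step = FAMILY piece (k3c3-p2's (F1) brick `rowSumWt_sliceCT_familySub_bgmFat_le` p597679 read at `(K, K′) := (K_{i+1}, K_i)`)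
+ COVARIANCE piece (k3c4-p2's `rowSumWt_sliceCT_sub_bgmFat_le` read at `(K, K′) := (K_i, K_{i+1})`) by k3c3-p2's `conj_step_split`.  This file is the
BOOKKEEPING for the tower's named objects, generic in the frame chain `K : ℕ → TrigPolyC4v`; the per-piece bounds are the suppliers' inputs (their literal
left-hand sides appear as hypotheses): §0 `sum_norm_chain_le_of_pieces` (sampled weighted norms along a chain of rectangular matrices — rows, columns,
sectional rows at once), `rowWt_/colWt_tnorm_le_of_klScaleWt` (suppliers' `klScaleWt nw` currency ⇒ `1 + Λ_w·tnorm`, `Λ_w ≤ Λ_nw`); §1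
`klStepCov_frame_sub_eq_pieces` (`klStepCov[K′] − klStepCov[K] = −Fam(K′,K) + Cov(K,K′)`, `C^K = hubbardCovSliceCT V M β μ 0 K Λ_{k+2} Λ_{k+1}`); §2
**`scaleCovData_klStepCov_of_frame_telescope`** (`ScaleCovData (klStepCov … (K (m₀+d)) k) Λ_w κ (αW + Σ_{i<d}(φ i + ψ i)) sW`); §3
**`scaleCovSecData_klStepCov_of_frame_telescope`** (sectional, from SECTIONAL ε-free pieces); §4 **`rowColSumWt_klReanalysis_of_frame_telescope`**,
**`transferWtData_klSrcTransfer_of_frame_telescope`** (re-analysis rows/columns and the transfer bundle from the base rows plus per-step bounds `χ i, χ′ i` on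
`klReanalysis[K_{i+1}] k − klReanalysis[K_i] k` — k3c4-p2's `exists_transfer_frameDefect_rate` shape via `klReanalysis_sub_apply_eq_frameDefect`, WEIGHTED twin asked).
Pure bookkeeping on landed theorems; no definitions; nothing asserts any stub, K3, VL or superconductivity. [cite: BenfattoGiulianiMastropietro2006, §3 (3.2)–(3.3)]
-/

noncomputable section

namespace Summit.HubbardSuperconductivity.HubbardSuperconductivity.Theorems.TorusFourierL2

set_option linter.dupNamespace false -- summit = problem name (single-conjunct summit), D-0017

open Set Finset Literature.MathematicalPhysics.QuantumLattice Literature.MathematicalPhysics.QuantumLattice.BandSectorCounting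
open Literature.MathematicalPhysics.QuantumLattice.FermiRG Literature.Probability.LatticeModels Literature.Analysis.SpecialFunctions
open Summit.HubbardSuperconductivity.HubbardSuperconductivity.Theorems.DispersionFlow
open Summit.HubbardSuperconductivity.HubbardSuperconductivity.Theorems.KLRegimeSplit
open Summit.HubbardSuperconductivity.HubbardSuperconductivity.Theorems.KLProgrammeLegKernels
open Summit.HubbardSuperconductivity.HubbardSuperconductivity.Theorems.PerturbedFermiCurve
open Summit.HubbardSuperconductivity.HubbardSuperconductivity.Theorems.KLRegimeWick
open Summit.HubbardSuperconductivity.HubbardSuperconductivity.Theorems.EngineV8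
open Summit.HubbardSuperconductivity.HubbardSuperconductivity.Theorems.TwoVolumeSource
open Summit.HubbardSuperconductivity.HubbardSuperconductivity.Theorems.TwoVolumeDefect
open scoped Real

open Classical

/-! ## §0 Chains of rectangular matrices sampled along any index map -/

section Chain

variable {α γ σ : Type*}

/-- Telescoping a chain of rectangular matrices: `A(m₀+d) = A(m₀) + Σ_{i<d} (A(m₀+i+1) − A(m₀+i))`. [folklore] -/
theorem matrix_chain_eq_rect (A : ℕ → Matrix α γ ℂ) (m₀ d : ℕ) :
    A (m₀ + d) = A m₀ + ∑ i ∈ range d, (A (m₀ + i + 1) - A (m₀ + i)) := by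
  induction d with
  | zero => simp
  | succ d ih =>
    rw [Finset.sum_range_succ, ← add_assoc (A m₀), ← ih, show m₀ + (d + 1) = m₀ + d + 1 by omega]
    abel

/-- **Weighted sampled norms along a chain whose steps split into two pieces with per-piece bounds.**  For any finite sampling `s ↦ (f s, g s)` of the
entries and nonnegative weights `w s`: if `A(m₀+i+1) − A(m₀+i) = F i + C i` with `Σ_s ‖F i (f s) (g s)‖·w s ≤ φ i` and `Σ_s ‖C i (f s) (g s)‖·w s ≤ ψ i`
for `i < d`, then `Σ_s ‖A(m₀+d) (f s) (g s)‖·w s ≤ Σ_s ‖A m₀ (f s) (g s)‖·w s + Σ_{i<d} (φ i + ψ i)` — rows (`f` constant), columns (`g` constant) and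
sectional rows (`g` ranging over a section) at once. [cite: BenfattoGiulianiMastropietro2006, §3 (3.2)–(3.3)] -/
theorem sum_norm_chain_le_of_pieces (A F C : ℕ → Matrix α γ ℂ) (S : Finset σ) (f : σ → α) (g : σ → γ) (w : σ → ℝ) (hw : ∀ s, 0 ≤ w s)
    (m₀ d : ℕ) (hsplit : ∀ i < d, A (m₀ + i + 1) - A (m₀ + i) = F i + C i) (φ ψ : ℕ → ℝ)
    (hF : ∀ i < d, ∑ s ∈ S, ‖F i (f s) (g s)‖ * w s ≤ φ i) (hC : ∀ i < d, ∑ s ∈ S, ‖C i (f s) (g s)‖ * w s ≤ ψ i) :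
    ∑ s ∈ S, ‖A (m₀ + d) (f s) (g s)‖ * w s ≤ ∑ s ∈ S, ‖A m₀ (f s) (g s)‖ * w s + ∑ i ∈ range d, (φ i + ψ i) := by
  rw [matrix_chain_eq_rect A m₀ d]
  calc ∑ s ∈ S, ‖(A m₀ + ∑ i ∈ range d, (A (m₀ + i + 1) - A (m₀ + i))) (f s) (g s)‖ * w s
      ≤ ∑ s ∈ S, (‖A m₀ (f s) (g s)‖ * w s + ∑ i ∈ range d, (‖F i (f s) (g s)‖ * w s + ‖C i (f s) (g s)‖ * w s)) := by
        refine Finset.sum_le_sum fun s _ => ?_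
        have hpt : ‖(A m₀ + ∑ i ∈ range d, (A (m₀ + i + 1) - A (m₀ + i))) (f s) (g s)‖ ≤
            ‖A m₀ (f s) (g s)‖ + ∑ i ∈ range d, (‖F i (f s) (g s)‖ + ‖C i (f s) (g s)‖) := by
          rw [Matrix.add_apply, Matrix.sum_apply]
          refine (norm_add_le _ _).trans (add_le_add le_rfl ((norm_sum_le _ _).trans (Finset.sum_le_sum fun i hi => ?_)))
          rw [Finset.mem_range] at hi
          rw [hsplit i hi, Matrix.add_apply]
          exact norm_add_le _ _
        calc ‖(A m₀ + ∑ i ∈ range d, (A (m₀ + i + 1) - A (m₀ + i))) (f s) (g s)‖ * w s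
            ≤ (‖A m₀ (f s) (g s)‖ + ∑ i ∈ range d, (‖F i (f s) (g s)‖ + ‖C i (f s) (g s)‖)) * w s := mul_le_mul_of_nonneg_right hpt (hw s)
          _ = ‖A m₀ (f s) (g s)‖ * w s + ∑ i ∈ range d, (‖F i (f s) (g s)‖ * w s + ‖C i (f s) (g s)‖ * w s) := by
              rw [add_mul, Finset.sum_mul]
              simp only [add_mul]
    _ = ∑ s ∈ S, ‖A m₀ (f s) (g s)‖ * w s + ∑ i ∈ range d, (∑ s ∈ S, ‖F i (f s) (g s)‖ * w s + ∑ s ∈ S, ‖C i (f s) (g s)‖ * w s) := by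
        rw [Finset.sum_add_distrib, Finset.sum_comm]
        simp only [Finset.sum_add_distrib]
    _ ≤ ∑ s ∈ S, ‖A m₀ (f s) (g s)‖ * w s + ∑ i ∈ range d, (φ i + ψ i) := by
        refine add_le_add le_rfl (Finset.sum_le_sum fun i hi => ?_)
        rw [Finset.mem_range] at hi
        exact add_le_add (hF i hi) (hC i hi)

/-- The same with ONE piece per step (`A(m₀+i+1) − A(m₀+i)` bounded directly by `θ i`). [folklore] -/
theorem sum_norm_chain_le_of_steps (A : ℕ → Matrix α γ ℂ) (S : Finset σ) (f : σ → α) (g : σ → γ) (w : σ → ℝ) (hw : ∀ s, 0 ≤ w s)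
    (m₀ d : ℕ) (θ : ℕ → ℝ) (hθ : ∀ i < d, ∑ s ∈ S, ‖(A (m₀ + i + 1) - A (m₀ + i)) (f s) (g s)‖ * w s ≤ θ i) :
    ∑ s ∈ S, ‖A (m₀ + d) (f s) (g s)‖ * w s ≤ ∑ s ∈ S, ‖A m₀ (f s) (g s)‖ * w s + ∑ i ∈ range d, θ i := by
  have h := sum_norm_chain_le_of_pieces A (fun i => A (m₀ + i + 1) - A (m₀ + i)) (fun _ => 0) S f g w hw m₀ d
    (fun i _ => by rw [add_zero]) θ (fun _ => 0) hθ (fun i _ => by simp)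
  simpa only [add_zero] using h

/-- A per-piece bound is nonnegative (it dominates a sum of nonnegative terms). [folklore] -/
theorem nonneg_of_sum_norm_mul_le {B : Matrix α γ ℂ} {S : Finset σ} {f : σ → α} {g : σ → γ} {w : σ → ℝ} (hw : ∀ s, 0 ≤ w s) {θ : ℝ}
    (h : ∑ s ∈ S, ‖B (f s) (g s)‖ * w s ≤ θ) : 0 ≤ θ :=
  le_trans (Finset.sum_nonneg fun s _ => mul_nonneg (norm_nonneg _) (hw s)) h

end Chain

section Currency

variable {V M Ns Ns' : ℕ} [NeZero V] [NeZero M]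

/-- **Supplier currency ⇒ bundle currency, rows**: a `klScaleWt V M β nw`-weighted row bound implies the `(1 + Λ_w·tnorm)`-weighted one for every
`Λ_w ≤ Λ_nw` (`0 ≤ β`; the legs may carry different sector counts — `latticeLegPos` forgets the leg). [folklore] -/
theorem rowWt_tnorm_le_of_klScaleWt {β : ℝ} (hβ : 0 ≤ β) {Λw : ℝ} {nw : ℕ} (hΛnw : Λw ≤ klScale klE0 nw)
    (B : Matrix (SpaceTimeIdx V M × SectorLeg Ns) (SpaceTimeIdx V M × SectorLeg Ns') ℂ) (X : SpaceTimeIdx V M × SectorLeg Ns) {θ : ℝ}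
    (h : ∑ Y, ‖B X Y‖ * EngineV8.klScaleWt V M β nw {EngineV8.latticeLegPos (2 * (2 * M)) X, EngineV8.latticeLegPos (2 * (2 * M)) Y} ≤ θ) :
    ∑ Y, ‖B X Y‖ * (1 + Λw * (Torus.tnorm (X.1.2 - Y.1.2) : ℝ)) ≤ θ := by
  refine le_trans (Finset.sum_le_sum fun Y _ => mul_le_mul_of_nonneg_left ?_ (norm_nonneg _)) h
  exact one_add_mul_tnorm_le_klScaleWt_pair hβ hΛnw ((X.1, Y.2) : SpaceTimeIdx V M × SectorLeg Ns') Y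

/-- **Supplier currency ⇒ bundle currency, columns.** [folklore] -/
theorem colWt_tnorm_le_of_klScaleWt {β : ℝ} (hβ : 0 ≤ β) {Λw : ℝ} {nw : ℕ} (hΛnw : Λw ≤ klScale klE0 nw)
    (B : Matrix (SpaceTimeIdx V M × SectorLeg Ns) (SpaceTimeIdx V M × SectorLeg Ns') ℂ) (Y : SpaceTimeIdx V M × SectorLeg Ns') {θ : ℝ}
    (h : ∑ X, ‖B X Y‖ * EngineV8.klScaleWt V M β nw {EngineV8.latticeLegPos (2 * (2 * M)) X, EngineV8.latticeLegPos (2 * (2 * M)) Y} ≤ θ) :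
    ∑ X, ‖B X Y‖ * (1 + Λw * (Torus.tnorm (X.1.2 - Y.1.2) : ℝ)) ≤ θ := by
  refine le_trans (Finset.sum_le_sum fun X _ => mul_le_mul_of_nonneg_left ?_ (norm_nonneg _)) h
  exact one_add_mul_tnorm_le_klScaleWt_pair hβ hΛnw ((X.1, Y.2) : SpaceTimeIdx V M × SectorLeg Ns') Y

end Currency

/-! ## §1 The step of the frame chain on `klStepCov`: family piece plus covariance piece -/

section Pieces

variable {V M : ℕ} [NeZero V]

/-- **One frame step of the tower's step covariance splits into the FAMILY piece and the COVARIANCE piece**: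
`klStepCov[K′] k − klStepCov[K] k = −Fam(K′,K) + Cov(K,K′)`, where `Fam(K′,K) = S(F̃_k[K])ᵀ C^{K′} S(F̃_k[K]) − S(F̃_k[K′])ᵀ C^{K′} S(F̃_k[K′])`
(k3c3-p2's `rowSumWt_sliceCT_familySub_bgmFat_le` left-hand side at `(K, K′) := (K′, K)`) and `Cov(K,K′) = S(F̃_k[K])ᵀ (C^{K′} − C^{K}) S(F̃_k[K])`
(k3c4-p2's `rowSumWt_sliceCT_sub_bgmFat_le`), `C^K = hubbardCovSliceCT V M β μ 0 K Λ_{k+2} Λ_{k+1}` (k3c3-p2 `conj_step_split`). [folklore] -/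
theorem klStepCov_frame_sub_eq_pieces (β μ : ℝ) (K K' : TrigPolyC4v) (k : ℕ) :
    klStepCov V M β μ K' k - klStepCov V M β μ K k =
      -((sectorSubMatrix V M β (bgmFatMultiplier V M klE0 β (nambuXiCT V μ K) k)).transpose *
            hubbardCovSliceCT V M β μ 0 K' (klScale klE0 (k + 2)) (klScale klE0 (k + 1)) *
            sectorSubMatrix V M β (bgmFatMultiplier V M klE0 β (nambuXiCT V μ K) k) -
          (sectorSubMatrix V M β (bgmFatMultiplier V M klE0 β (nambuXiCT V μ K') k)).transpose *
            hubbardCovSliceCT V M β μ 0 K' (klScale klE0 (k + 2)) (klScale klE0 (k + 1)) *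
            sectorSubMatrix V M β (bgmFatMultiplier V M klE0 β (nambuXiCT V μ K') k)) +
        (sectorSubMatrix V M β (bgmFatMultiplier V M klE0 β (nambuXiCT V μ K) k)).transpose *
          (hubbardCovSliceCT V M β μ 0 K' (klScale klE0 (k + 2)) (klScale klE0 (k + 1)) -
            hubbardCovSliceCT V M β μ 0 K (klScale klE0 (k + 2)) (klScale klE0 (k + 1))) *
          sectorSubMatrix V M β (bgmFatMultiplier V M klE0 β (nambuXiCT V μ K) k) := by
  simp only [klStepCov, Matrix.mul_sub, Matrix.sub_mul, neg_sub]
  abel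

end Pieces

/-! ## §2 The covariance bundle at the last frame of a chain -/

section CovTelescope

variable {V M : ℕ} [NeZero V] [NeZero M]

set_option maxHeartbeats 800000 in -- long statement
/-- **`ScaleCovData` of `klStepCov` at the last frame of a frame chain from the first frame plus the pieces.**  Frames `K : ℕ → TrigPolyC4v`, fat scale `k`,
chain `K m₀ → ⋯ → K (m₀+d)`, rate `Λ_w ≥ 0`.  Inputs: the base bundle at `K m₀` (p3's `scaleCovData_klStepCov_klEng_flow_deep_vol_at`), the window-free Gram
constant `κ` and entry sup `sW` at `K (m₀+d)` (p3's `gram_entry_klStepCov_klEng`), and for every step `i < d` the `(1 + Λ_w·tnorm)`-weighted rows AND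
columns of the family piece `Fam(K_{i+1}, K_i)` (`≤ φ i`) and of the covariance piece `Cov(K_i, K_{i+1})` (`≤ ψ i`).  Output:
`ScaleCovData (klStepCov V M β μ (K (m₀+d)) k) Λ_w κ (αW + Σ_{i<d}(φ i + ψ i)) sW`. [cite: BenfattoGiulianiMastropietro2006, §3 (3.2)–(3.3)] -/
theorem scaleCovData_klStepCov_of_frame_telescope (β μ : ℝ) (K : ℕ → TrigPolyC4v) (k m₀ d : ℕ) {Λw κ₀ αW sW₀ κ sW : ℝ} (hΛw : 0 ≤ Λw)
    (hbase : ScaleCovData (klStepCov V M β μ (K m₀) k) Λw κ₀ αW sW₀)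
    (hκ : 0 < κ) (hgram : IsGramBoundedR (klStepCov V M β μ (K (m₀ + d)) k) κ)
    (hsW : 0 ≤ sW) (hentry : ∀ X Y, ‖klStepCov V M β μ (K (m₀ + d)) k X Y‖ ≤ sW)
    (φ ψ : ℕ → ℝ)
    (hFrow : ∀ i < d, ∀ X : SpaceTimeIdx V M × SectorLeg (sectorCount k), ∑ Y : SpaceTimeIdx V M × SectorLeg (sectorCount k),
      ‖((sectorSubMatrix V M β (bgmFatMultiplier V M klE0 β (nambuXiCT V μ (K (m₀ + i))) k)).transpose *
            hubbardCovSliceCT V M β μ 0 (K (m₀ + i + 1)) (klScale klE0 (k + 2)) (klScale klE0 (k + 1)) *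
            sectorSubMatrix V M β (bgmFatMultiplier V M klE0 β (nambuXiCT V μ (K (m₀ + i))) k) -
          (sectorSubMatrix V M β (bgmFatMultiplier V M klE0 β (nambuXiCT V μ (K (m₀ + i + 1))) k)).transpose *
            hubbardCovSliceCT V M β μ 0 (K (m₀ + i + 1)) (klScale klE0 (k + 2)) (klScale klE0 (k + 1)) *
            sectorSubMatrix V M β (bgmFatMultiplier V M klE0 β (nambuXiCT V μ (K (m₀ + i + 1))) k)) X Y‖ *
        (1 + Λw * (Torus.tnorm (X.1.2 - Y.1.2) : ℝ)) ≤ φ i)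
    (hFcol : ∀ i < d, ∀ Y : SpaceTimeIdx V M × SectorLeg (sectorCount k), ∑ X : SpaceTimeIdx V M × SectorLeg (sectorCount k),
      ‖((sectorSubMatrix V M β (bgmFatMultiplier V M klE0 β (nambuXiCT V μ (K (m₀ + i))) k)).transpose *
            hubbardCovSliceCT V M β μ 0 (K (m₀ + i + 1)) (klScale klE0 (k + 2)) (klScale klE0 (k + 1)) *
            sectorSubMatrix V M β (bgmFatMultiplier V M klE0 β (nambuXiCT V μ (K (m₀ + i))) k) -
          (sectorSubMatrix V M β (bgmFatMultiplier V M klE0 β (nambuXiCT V μ (K (m₀ + i + 1))) k)).transpose *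
            hubbardCovSliceCT V M β μ 0 (K (m₀ + i + 1)) (klScale klE0 (k + 2)) (klScale klE0 (k + 1)) *
            sectorSubMatrix V M β (bgmFatMultiplier V M klE0 β (nambuXiCT V μ (K (m₀ + i + 1))) k)) X Y‖ *
        (1 + Λw * (Torus.tnorm (X.1.2 - Y.1.2) : ℝ)) ≤ φ i)
    (hCrow : ∀ i < d, ∀ X : SpaceTimeIdx V M × SectorLeg (sectorCount k), ∑ Y : SpaceTimeIdx V M × SectorLeg (sectorCount k),
      ‖((sectorSubMatrix V M β (bgmFatMultiplier V M klE0 β (nambuXiCT V μ (K (m₀ + i))) k)).transpose *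
          (hubbardCovSliceCT V M β μ 0 (K (m₀ + i + 1)) (klScale klE0 (k + 2)) (klScale klE0 (k + 1)) -
            hubbardCovSliceCT V M β μ 0 (K (m₀ + i)) (klScale klE0 (k + 2)) (klScale klE0 (k + 1))) *
          sectorSubMatrix V M β (bgmFatMultiplier V M klE0 β (nambuXiCT V μ (K (m₀ + i))) k)) X Y‖ *
        (1 + Λw * (Torus.tnorm (X.1.2 - Y.1.2) : ℝ)) ≤ ψ i)
    (hCcol : ∀ i < d, ∀ Y : SpaceTimeIdx V M × SectorLeg (sectorCount k), ∑ X : SpaceTimeIdx V M × SectorLeg (sectorCount k),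
      ‖((sectorSubMatrix V M β (bgmFatMultiplier V M klE0 β (nambuXiCT V μ (K (m₀ + i))) k)).transpose *
          (hubbardCovSliceCT V M β μ 0 (K (m₀ + i + 1)) (klScale klE0 (k + 2)) (klScale klE0 (k + 1)) -
            hubbardCovSliceCT V M β μ 0 (K (m₀ + i)) (klScale klE0 (k + 2)) (klScale klE0 (k + 1))) *
          sectorSubMatrix V M β (bgmFatMultiplier V M klE0 β (nambuXiCT V μ (K (m₀ + i))) k)) X Y‖ *
        (1 + Λw * (Torus.tnorm (X.1.2 - Y.1.2) : ℝ)) ≤ ψ i) :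
    ScaleCovData (klStepCov V M β μ (K (m₀ + d)) k) Λw κ (αW + ∑ i ∈ range d, (φ i + ψ i)) sW := by
  have hw : ∀ (X Y : SpaceTimeIdx V M × SectorLeg (sectorCount k)), 0 ≤ 1 + Λw * (Torus.tnorm (X.1.2 - Y.1.2) : ℝ) :=
    fun X Y => by positivity
  -- the chain and its pieces (`F i := −Fam`, `C i := Cov`)
  have hsplit : ∀ i < d, klStepCov V M β μ (K (m₀ + i + 1)) k - klStepCov V M β μ (K (m₀ + i)) k =
      -((sectorSubMatrix V M β (bgmFatMultiplier V M klE0 β (nambuXiCT V μ (K (m₀ + i))) k)).transpose *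
            hubbardCovSliceCT V M β μ 0 (K (m₀ + i + 1)) (klScale klE0 (k + 2)) (klScale klE0 (k + 1)) *
            sectorSubMatrix V M β (bgmFatMultiplier V M klE0 β (nambuXiCT V μ (K (m₀ + i))) k) -
          (sectorSubMatrix V M β (bgmFatMultiplier V M klE0 β (nambuXiCT V μ (K (m₀ + i + 1))) k)).transpose *
            hubbardCovSliceCT V M β μ 0 (K (m₀ + i + 1)) (klScale klE0 (k + 2)) (klScale klE0 (k + 1)) *
            sectorSubMatrix V M β (bgmFatMultiplier V M klE0 β (nambuXiCT V μ (K (m₀ + i + 1))) k)) +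
        (sectorSubMatrix V M β (bgmFatMultiplier V M klE0 β (nambuXiCT V μ (K (m₀ + i))) k)).transpose *
          (hubbardCovSliceCT V M β μ 0 (K (m₀ + i + 1)) (klScale klE0 (k + 2)) (klScale klE0 (k + 1)) -
            hubbardCovSliceCT V M β μ 0 (K (m₀ + i)) (klScale klE0 (k + 2)) (klScale klE0 (k + 1))) *
          sectorSubMatrix V M β (bgmFatMultiplier V M klE0 β (nambuXiCT V μ (K (m₀ + i))) k) :=
    fun i _ => klStepCov_frame_sub_eq_pieces β μ (K (m₀ + i)) (K (m₀ + i + 1)) k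
  have hφψ : 0 ≤ ∑ i ∈ range d, (φ i + ψ i) := by
    refine Finset.sum_nonneg fun i hi => ?_
    rw [Finset.mem_range] at hi
    obtain ⟨X₀⟩ : Nonempty (SpaceTimeIdx V M × SectorLeg (sectorCount k)) :=
      ⟨((0, 0), ((⟨0, sectorCount_pos k⟩, 0), 0))⟩
    exact add_nonneg
      (nonneg_of_sum_norm_mul_le (S := (Finset.univ : Finset (SpaceTimeIdx V M × SectorLeg (sectorCount k)))) (f := fun _ => X₀) (g := id)
        (fun Y => hw X₀ Y) (hFrow i hi X₀))
      (nonneg_of_sum_norm_mul_le (S := (Finset.univ : Finset (SpaceTimeIdx V M × SectorLeg (sectorCount k)))) (f := fun _ => X₀) (g := id)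
        (fun Y => hw X₀ Y) (hCrow i hi X₀))
  refine ⟨hκ, hgram, by linarith [hbase.αW_pos], fun X => ?_, fun Y => ?_, hsW, hentry⟩
  · -- rows
    have h := sum_norm_chain_le_of_pieces (σ := SpaceTimeIdx V M × SectorLeg (sectorCount k))
      (fun i => klStepCov V M β μ (K i) k) _ _ Finset.univ (fun _ => X) id (fun Y => 1 + Λw * (Torus.tnorm (X.1.2 - Y.1.2) : ℝ))
      (fun Y => hw X Y) m₀ d hsplit φ ψ
      (fun i hi => by simpa only [Matrix.neg_apply, norm_neg, id] using hFrow i hi X) (fun i hi => by simpa only [id] using hCrow i hi X)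
    simp only [id] at h
    exact h.trans (add_le_add (hbase.row X) le_rfl)
  · -- columns
    have h := sum_norm_chain_le_of_pieces (σ := SpaceTimeIdx V M × SectorLeg (sectorCount k))
      (fun i => klStepCov V M β μ (K i) k) _ _ Finset.univ id (fun _ => Y) (fun X => 1 + Λw * (Torus.tnorm (X.1.2 - Y.1.2) : ℝ))
      (fun X => hw X Y) m₀ d hsplit φ ψ
      (fun i hi => by simpa only [Matrix.neg_apply, norm_neg, id] using hFcol i hi Y) (fun i hi => by simpa only [id] using hCcol i hi Y)
    simp only [id] at h
    exact h.trans (add_le_add (hbase.col Y) le_rfl)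

end CovTelescope

/-! ## §3 The sectional row at the last frame of a chain -/

section SecTelescope

variable {V M : ℕ} [NeZero V]

set_option maxHeartbeats 800000 in -- long statement
/-- **`ScaleCovSecData` of `klStepCov` at the last frame of a frame chain from the first frame plus SECTIONAL pieces**: for every step `i < d`, the
`(1 + Λ_w·tnorm)`-weighted SECTIONAL rows (fixed out-leg `X`, time `t`, label `ℓ`; sum over the sites `y`) of the family piece `Fam(K_{i+1},K_i)`
(`≤ φ i`) and of the covariance piece `Cov(K_i,K_{i+1})` (`≤ ψ i`) — ε-free inputs — give
`ScaleCovSecData (klStepCov V M β μ (K (m₀+d)) k) Λ_w (eW + Σ_{i<d}(φ i + ψ i))` from the base `ScaleCovSecData … (K m₀) … Λ_w eW`.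
[cite: BenfattoGiulianiMastropietro2006, §3 (3.2)–(3.3)] -/
theorem scaleCovSecData_klStepCov_of_frame_telescope (β μ : ℝ) (K : ℕ → TrigPolyC4v) (k m₀ d : ℕ) {Λw eW : ℝ} (hΛw : 0 ≤ Λw)
    (hbase : ScaleCovSecData (klStepCov V M β μ (K m₀) k) Λw eW)
    (φ ψ : ℕ → ℝ)
    (hFsec : ∀ i < d, ∀ (X : SpaceTimeIdx V M × SectorLeg (sectorCount k)) (t : ImagTimeIdx M) (ℓ : SectorLeg (sectorCount k)),
      ∑ y : TorusSite 2 V,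
      ‖((sectorSubMatrix V M β (bgmFatMultiplier V M klE0 β (nambuXiCT V μ (K (m₀ + i))) k)).transpose *
            hubbardCovSliceCT V M β μ 0 (K (m₀ + i + 1)) (klScale klE0 (k + 2)) (klScale klE0 (k + 1)) *
            sectorSubMatrix V M β (bgmFatMultiplier V M klE0 β (nambuXiCT V μ (K (m₀ + i))) k) -
          (sectorSubMatrix V M β (bgmFatMultiplier V M klE0 β (nambuXiCT V μ (K (m₀ + i + 1))) k)).transpose *
            hubbardCovSliceCT V M β μ 0 (K (m₀ + i + 1)) (klScale klE0 (k + 2)) (klScale klE0 (k + 1)) *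
            sectorSubMatrix V M β (bgmFatMultiplier V M klE0 β (nambuXiCT V μ (K (m₀ + i + 1))) k)) X ((t, y), ℓ)‖ *
        (1 + Λw * (Torus.tnorm (X.1.2 - y) : ℝ)) ≤ φ i)
    (hCsec : ∀ i < d, ∀ (X : SpaceTimeIdx V M × SectorLeg (sectorCount k)) (t : ImagTimeIdx M) (ℓ : SectorLeg (sectorCount k)),
      ∑ y : TorusSite 2 V,
      ‖((sectorSubMatrix V M β (bgmFatMultiplier V M klE0 β (nambuXiCT V μ (K (m₀ + i))) k)).transpose *
          (hubbardCovSliceCT V M β μ 0 (K (m₀ + i + 1)) (klScale klE0 (k + 2)) (klScale klE0 (k + 1)) -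
            hubbardCovSliceCT V M β μ 0 (K (m₀ + i)) (klScale klE0 (k + 2)) (klScale klE0 (k + 1))) *
          sectorSubMatrix V M β (bgmFatMultiplier V M klE0 β (nambuXiCT V μ (K (m₀ + i))) k)) X ((t, y), ℓ)‖ *
        (1 + Λw * (Torus.tnorm (X.1.2 - y) : ℝ)) ≤ ψ i) :
    ScaleCovSecData (klStepCov V M β μ (K (m₀ + d)) k) Λw (eW + ∑ i ∈ range d, (φ i + ψ i)) := by
  refine ⟨fun X t ℓ => ?_⟩
  have hw : ∀ y : TorusSite 2 V, 0 ≤ 1 + Λw * (Torus.tnorm (X.1.2 - y) : ℝ) := fun y => by positivity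
  have h := sum_norm_chain_le_of_pieces (σ := TorusSite 2 V) (fun i => klStepCov V M β μ (K i) k) _ _ Finset.univ (fun _ => X)
    (fun y => (((t, y), ℓ) : SpaceTimeIdx V M × SectorLeg (sectorCount k))) (fun y => 1 + Λw * (Torus.tnorm (X.1.2 - y) : ℝ)) hw m₀ d
    (fun i _ => klStepCov_frame_sub_eq_pieces β μ (K (m₀ + i)) (K (m₀ + i + 1)) k) φ ψ
    (fun i hi => by simpa only [Matrix.neg_apply, norm_neg] using hFsec i hi X t ℓ) (fun i hi => hCsec i hi X t ℓ)
  exact h.trans (add_le_add (hbase.sec X t ℓ) le_rfl)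

end SecTelescope

/-! ## §4 The re-analysis rows and the transfer bundle at the last frame of a chain -/

section TransferTelescope

variable {V M : ℕ} [NeZero V]

/-- **Weighted rows and columns of `klReanalysis` at the last frame of a frame chain**: base rows/columns at `K m₀`
(`rowColSumWt_klReanalysis_klEng_flow_deep_vol_at`) plus per-step bounds `χ i` (rows) and `χ′ i` (columns) on the `klScaleWt V M β (k+1)`-weighted
rows/columns of the increments `klReanalysis[K_{i+1}] k − klReanalysis[K_i] k` (entrywise k3c4-p2's transfer frame defect, `klReanalysis_sub_apply_eq_frameDefect`).
[cite: BenfattoGiulianiMastropietro2006, §2.7 (2.71a), §3 (3.3)] -/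
theorem rowColSumWt_klReanalysis_of_frame_telescope (β μ : ℝ) (K : ℕ → TrigPolyC4v) (k m₀ d : ℕ) {Cr : ℝ}
    (hbrow : ∀ X'' : SpaceTimeIdx V M × SectorLeg (sectorCount (k + 1)),
      ∑ X' : SpaceTimeIdx V M × SectorLeg (sectorCount k), ‖klReanalysis V M β μ (K m₀) k X'' X'‖ *
        EngineV8.klScaleWt V M β (k + 1) {EngineV8.latticeLegPos (2 * (2 * M)) X'', EngineV8.latticeLegPos (2 * (2 * M)) X'} ≤ Cr)
    (hbcol : ∀ X' : SpaceTimeIdx V M × SectorLeg (sectorCount k),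
      ∑ X'' : SpaceTimeIdx V M × SectorLeg (sectorCount (k + 1)), ‖klReanalysis V M β μ (K m₀) k X'' X'‖ *
        EngineV8.klScaleWt V M β (k + 1) {EngineV8.latticeLegPos (2 * (2 * M)) X'', EngineV8.latticeLegPos (2 * (2 * M)) X'} ≤ Cr)
    (χ χ' : ℕ → ℝ)
    (hrow : ∀ i < d, ∀ X'' : SpaceTimeIdx V M × SectorLeg (sectorCount (k + 1)),
      ∑ X' : SpaceTimeIdx V M × SectorLeg (sectorCount k),
        ‖(klReanalysis V M β μ (K (m₀ + i + 1)) k - klReanalysis V M β μ (K (m₀ + i)) k) X'' X'‖ *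
          EngineV8.klScaleWt V M β (k + 1) {EngineV8.latticeLegPos (2 * (2 * M)) X'', EngineV8.latticeLegPos (2 * (2 * M)) X'} ≤ χ i)
    (hcol : ∀ i < d, ∀ X' : SpaceTimeIdx V M × SectorLeg (sectorCount k),
      ∑ X'' : SpaceTimeIdx V M × SectorLeg (sectorCount (k + 1)),
        ‖(klReanalysis V M β μ (K (m₀ + i + 1)) k - klReanalysis V M β μ (K (m₀ + i)) k) X'' X'‖ *
          EngineV8.klScaleWt V M β (k + 1) {EngineV8.latticeLegPos (2 * (2 * M)) X'', EngineV8.latticeLegPos (2 * (2 * M)) X'} ≤ χ' i) :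
    (∀ X'' : SpaceTimeIdx V M × SectorLeg (sectorCount (k + 1)),
      ∑ X' : SpaceTimeIdx V M × SectorLeg (sectorCount k), ‖klReanalysis V M β μ (K (m₀ + d)) k X'' X'‖ *
        EngineV8.klScaleWt V M β (k + 1) {EngineV8.latticeLegPos (2 * (2 * M)) X'', EngineV8.latticeLegPos (2 * (2 * M)) X'} ≤
          Cr + ∑ i ∈ range d, χ i) ∧
    (∀ X' : SpaceTimeIdx V M × SectorLeg (sectorCount k),
      ∑ X'' : SpaceTimeIdx V M × SectorLeg (sectorCount (k + 1)), ‖klReanalysis V M β μ (K (m₀ + d)) k X'' X'‖ *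
        EngineV8.klScaleWt V M β (k + 1) {EngineV8.latticeLegPos (2 * (2 * M)) X'', EngineV8.latticeLegPos (2 * (2 * M)) X'} ≤
          Cr + ∑ i ∈ range d, χ' i) := by
  have hw : ∀ (X'' : SpaceTimeIdx V M × SectorLeg (sectorCount (k + 1))) (X' : SpaceTimeIdx V M × SectorLeg (sectorCount k)),
      0 ≤ EngineV8.klScaleWt V M β (k + 1) {EngineV8.latticeLegPos (2 * (2 * M)) X'', EngineV8.latticeLegPos (2 * (2 * M)) X'} :=
    fun X'' X' => zero_le_one.trans (EngineV8.one_le_klScaleWt _ _ _ _ _)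
  refine ⟨fun X'' => ?_, fun X' => ?_⟩
  · have h := sum_norm_chain_le_of_steps (σ := SpaceTimeIdx V M × SectorLeg (sectorCount k)) (fun i => klReanalysis V M β μ (K i) k)
      Finset.univ (fun _ => X'') id
      (fun X' => EngineV8.klScaleWt V M β (k + 1) {EngineV8.latticeLegPos (2 * (2 * M)) X'', EngineV8.latticeLegPos (2 * (2 * M)) X'})
      (fun X' => hw X'' X') m₀ d χ (fun i hi => by simpa only [id] using hrow i hi X'')
    simp only [id] at h
    exact h.trans (add_le_add (hbrow X'') le_rfl)
  · have h := sum_norm_chain_le_of_steps (σ := SpaceTimeIdx V M × SectorLeg (sectorCount (k + 1))) (fun i => klReanalysis V M β μ (K i) k)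
      Finset.univ id (fun _ => X')
      (fun X'' => EngineV8.klScaleWt V M β (k + 1) {EngineV8.latticeLegPos (2 * (2 * M)) X'', EngineV8.latticeLegPos (2 * (2 * M)) X'})
      (fun X'' => hw X'' X') m₀ d χ' (fun i hi => by simpa only [id] using hcol i hi X')
    simp only [id] at h
    exact h.trans (add_le_add (hbcol X') le_rfl)

end TransferTelescope

section TransferBundle

variable {L b M : ℕ} [NeZero L] [NeZero (b * L)] [NeZero M]

/-- **`TransferWtData` of the doubled transfer at the last frame of a frame chain** on the fine lattice `b·L`: the base rows/columns at `K m₀` plus the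
per-step increment bounds `χ i, χ′ i` give, through `rowColSumWt_klReanalysis_of_frame_telescope` and `transferWtData_klSrcTransfer_of_rowColSumWt`,
`TransferWtData (klSrcTransfer (b·L) M β μ (K (m₀+d)) k) (klBlockEquivD L b M (k+1)) (klBlockEquivD L b M k) Λ_T (Cr + Σ_{i<d}(χ i + χ′ i) + 1)` for every
`0 ≤ Λ_T ≤ Λ_{k+1}`. [cite: BenfattoGiulianiMastropietro2006, §2.7 (2.70)–(2.71a), §3 (3.2)–(3.8)] -/
theorem transferWtData_klSrcTransfer_of_frame_telescope {β : ℝ} (hβ : 0 < β) (μ : ℝ) (K : ℕ → TrigPolyC4v) (k m₀ d : ℕ) {Cr ΛT : ℝ}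
    (hCr : 0 ≤ Cr) (hΛT : 0 ≤ ΛT) (hΛTle : ΛT ≤ klScale klE0 (k + 1))
    (hbrow : ∀ X'' : SpaceTimeIdx (b * L) M × SectorLeg (sectorCount (k + 1)),
      ∑ X' : SpaceTimeIdx (b * L) M × SectorLeg (sectorCount k), ‖klReanalysis (b * L) M β μ (K m₀) k X'' X'‖ *
        EngineV8.klScaleWt (b * L) M β (k + 1) {EngineV8.latticeLegPos (2 * (2 * M)) X'', EngineV8.latticeLegPos (2 * (2 * M)) X'} ≤ Cr)
    (hbcol : ∀ X' : SpaceTimeIdx (b * L) M × SectorLeg (sectorCount k),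
      ∑ X'' : SpaceTimeIdx (b * L) M × SectorLeg (sectorCount (k + 1)), ‖klReanalysis (b * L) M β μ (K m₀) k X'' X'‖ *
        EngineV8.klScaleWt (b * L) M β (k + 1) {EngineV8.latticeLegPos (2 * (2 * M)) X'', EngineV8.latticeLegPos (2 * (2 * M)) X'} ≤ Cr)
    (χ χ' : ℕ → ℝ)
    (hrow : ∀ i < d, ∀ X'' : SpaceTimeIdx (b * L) M × SectorLeg (sectorCount (k + 1)),
      ∑ X' : SpaceTimeIdx (b * L) M × SectorLeg (sectorCount k),
        ‖(klReanalysis (b * L) M β μ (K (m₀ + i + 1)) k - klReanalysis (b * L) M β μ (K (m₀ + i)) k) X'' X'‖ *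
          EngineV8.klScaleWt (b * L) M β (k + 1) {EngineV8.latticeLegPos (2 * (2 * M)) X'', EngineV8.latticeLegPos (2 * (2 * M)) X'} ≤ χ i)
    (hcol : ∀ i < d, ∀ X' : SpaceTimeIdx (b * L) M × SectorLeg (sectorCount k),
      ∑ X'' : SpaceTimeIdx (b * L) M × SectorLeg (sectorCount (k + 1)),
        ‖(klReanalysis (b * L) M β μ (K (m₀ + i + 1)) k - klReanalysis (b * L) M β μ (K (m₀ + i)) k) X'' X'‖ *
          EngineV8.klScaleWt (b * L) M β (k + 1) {EngineV8.latticeLegPos (2 * (2 * M)) X'', EngineV8.latticeLegPos (2 * (2 * M)) X'} ≤ χ' i) :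
    TransferWtData (klSrcTransfer (b * L) M β μ (K (m₀ + d)) k) (klBlockEquivD L b M (k + 1)) (klBlockEquivD L b M k) ΛT
      (Cr + ∑ i ∈ range d, (χ i + χ' i) + 1) := by
  obtain ⟨hr, hc⟩ := rowColSumWt_klReanalysis_of_frame_telescope (V := b * L) β μ K k m₀ d hbrow hbcol χ χ' hrow hcol
  have hw : ∀ (X'' : SpaceTimeIdx (b * L) M × SectorLeg (sectorCount (k + 1))) (X' : SpaceTimeIdx (b * L) M × SectorLeg (sectorCount k)),
      0 ≤ EngineV8.klScaleWt (b * L) M β (k + 1) {EngineV8.latticeLegPos (2 * (2 * M)) X'', EngineV8.latticeLegPos (2 * (2 * M)) X'} :=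
    fun X'' X' => zero_le_one.trans (EngineV8.one_le_klScaleWt _ _ _ _ _)
  have hχ : ∀ i ∈ range d, 0 ≤ χ i := fun i hi => by
    rw [Finset.mem_range] at hi
    obtain ⟨X₀⟩ : Nonempty (SpaceTimeIdx (b * L) M × SectorLeg (sectorCount (k + 1))) := ⟨((0, 0), ((⟨0, sectorCount_pos (k + 1)⟩, 0), 0))⟩
    exact nonneg_of_sum_norm_mul_le (S := (Finset.univ : Finset (SpaceTimeIdx (b * L) M × SectorLeg (sectorCount k)))) (f := fun _ => X₀)
      (g := id) (fun X' => hw X₀ X') (hrow i hi X₀)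
  have hχ' : ∀ i ∈ range d, 0 ≤ χ' i := fun i hi => by
    rw [Finset.mem_range] at hi
    obtain ⟨Y₀⟩ : Nonempty (SpaceTimeIdx (b * L) M × SectorLeg (sectorCount k)) := ⟨((0, 0), ((⟨0, sectorCount_pos k⟩, 0), 0))⟩
    exact nonneg_of_sum_norm_mul_le (S := (Finset.univ : Finset (SpaceTimeIdx (b * L) M × SectorLeg (sectorCount (k + 1))))) (f := id)
      (g := fun _ => Y₀) (fun X'' => hw X'' Y₀) (hcol i hi Y₀)
  have hsum : ∑ i ∈ range d, χ i ≤ ∑ i ∈ range d, (χ i + χ' i) := Finset.sum_le_sum fun i hi => le_add_of_nonneg_right (hχ' i hi)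
  have hsum' : ∑ i ∈ range d, χ' i ≤ ∑ i ∈ range d, (χ i + χ' i) := Finset.sum_le_sum fun i hi => le_add_of_nonneg_left (hχ i hi)
  have hCr' : 0 ≤ Cr + ∑ i ∈ range d, (χ i + χ' i) := add_nonneg hCr (Finset.sum_nonneg fun i hi => add_nonneg (hχ i hi) (hχ' i hi))
  exact transferWtData_klSrcTransfer_of_rowColSumWt hβ μ (K (m₀ + d)) k hCr' hΛT hΛTle (fun X'' => (hr X'').trans (by linarith))
    (fun X' => (hc X').trans (by linarith))

end TransferBundle

end Summit.HubbardSuperconductivity.HubbardSuperconductivity.Theorems.TorusFourierL2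

end
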